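import Mathlib
import HarnessLib
import Literature.MathematicalPhysics.KineticTheory.HardSphereEuler
import Literature.MathematicalPhysics.KineticTheory.BackwardCluster
import Literature.MathematicalPhysics.KineticTheory.GoodConfigurations

/-!
# Stub `stub_windowComposition` of the line `Sketch` (log-window-tagged-tail) for the crux
`RelayRaceLocality.GibbsLightCone` (stmt-AtomisticToContinuum-12501)

Registered stub of the lead prover's skeleton (`Cruxes/GibbsLightCone/Lines/Sketch.lean`): the
deterministic WINDOW COMPOSITION step on one good orbit of a hard-sphere flow `Φ` on `T³`.
Backward clusters (Aoki–Pulvirenti–Simonella–Tsuji 2015 §1, §5;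
`Literature.MathematicalPhysics.KineticTheory.BackwardCluster`) compose over time windows: if
over every window `(aW, (a+1)W]`, `a < n`, every member `r` of `{q} ∪ BC(q, (aW, (a+1)W])` sits
at time `aW` within minimal-image distance `L` of `x_q((a+1)W)`, then every member `j` of
`{i} ∪ BC(i, (0, nW])` sits at time `0` within `n · L` of `x_i(nW)`.

Proof: induction on `n`. The window `(0, (n+1)W]` splits at `nW`
(`backwardSweep_eq_sweep`): the running cluster of `i` over `(0, (n+1)W]` is the sweep over the
collisions in `(0, nW]` started from the running cluster `S` of `i` over `(nW, (n+1)W]`; and a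
sweep started from `S` is the union over `q ∈ S` of the sweeps started from `{q}`
(`windowComposition_mem_sweep_fst_iff`: the backward step `clusterStep E` distributes over
unions, and the recollision counter never feeds back into the running cluster). Hence
`j ∈ {q} ∪ BC(q, (0, nW])` for some `q ∈ {i} ∪ BC(i, (nW, (n+1)W])`
(`windowComposition_exists_mem`), and the triangle inequality for the minimal-image distance
`Torus.euclidDist` through `x_q(nW)` (`torus_euclidDist_triangle`) closes the induction.
-/

namespace Summit.AtomisticToContinuum.HydrodynamicLimit.Theorems.LogWindowTaggedTail

open Literature.MathematicalPhysics.KineticTheory Literature.Analysis.FluidPDE MeasureTheory Filter Set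

/-- The running cluster of a backward sweep depends on the initial running cluster through a
union: `x` is swept in starting from `init` iff it is swept in starting from some single member
`q` of the initial running cluster (the backward step
`clusterStep E S = S ∪ {partners in E of members of S}` distributes over unions of `S`; the
recollision counter does not feed back into the cluster). [folklore] -/
theorem windowComposition_mem_sweep_fst_iff {N : ℕ} (Es : List (Finset (Sym2 (Fin N))))
    (init : Finset (Fin N) × ℕ) (x : Fin N) :
    x ∈ (sweep Es init).1 ↔ ∃ q ∈ init.1, x ∈ (sweep Es ({q}, 0)).1 := by
  induction Es generalizing x with
  | nil => simp
  | cons E Es ih =>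
    simp only [sweep_cons, sweepStep, mem_clusterStep, ih]
    constructor
    · rintro (⟨q, hq, hx⟩ | ⟨j, ⟨q, hq, hj⟩, hE⟩)
      · exact ⟨q, hq, Or.inl hx⟩
      · exact ⟨q, hq, Or.inr ⟨j, hj, hE⟩⟩
    · rintro ⟨q, hq, hx | ⟨j, hj, hE⟩⟩
      · exact Or.inl ⟨q, hq, hx⟩
      · exact Or.inr ⟨j, ⟨q, hq, hj⟩, hE⟩

/-- **Windows compose** (membership form): splitting the window `(s, t]` at an intermediate time
`u`, every member `j` of `{i} ∪ BC(i, (s, t])` belongs to `{q} ∪ BC(q, (s, u])` for some member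
`q` of `{i} ∪ BC(i, (u, t])` — the backward sweep over `(s, t]` is the sweep over the
collisions in `(s, u]` started from the running cluster over `(u, t]`
(`backwardSweep_eq_sweep`, APST 2015 §1 "iterate this procedure"), and sweeps distribute over
the initial running cluster (`windowComposition_mem_sweep_fst_iff`). [folklore] -/
theorem windowComposition_exists_mem {d X : Type*} [Fintype d] {N : ℕ} {G : Geometry d X}
    {ε : ℝ} {γ : ℝ → Config N d X} {i j : Fin N} {s u t : ℝ} (hsu : s ≤ u) (hut : u ≤ t)
    (hfin : (collisionTimes G ε γ ∩ Ioc s t).Finite)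
    (hj : j = i ∨ j ∈ backwardCluster G ε γ i s t) :
    ∃ q : Fin N, (q = i ∨ q ∈ backwardCluster G ε γ i u t) ∧
      (j = q ∨ j ∈ backwardCluster G ε γ q s u) := by
  have hj' : j ∈ (backwardSweep G ε γ i s t).1 := by
    rw [backwardSweep_fst_eq_insert, Finset.mem_insert]
    exact hj
  rw [backwardSweep_eq_sweep hsu hut hfin, windowComposition_mem_sweep_fst_iff] at hj'
  obtain ⟨q, hq, hjq⟩ := hj'
  refine ⟨q, ?_, ?_⟩
  · rw [backwardSweep_fst_eq_insert, Finset.mem_insert] at hq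
    exact hq
  · change j ∈ (backwardSweep G ε γ q s u).1 at hjq
    rw [backwardSweep_fst_eq_insert, Finset.mem_insert] at hjq
    exact hjq

/-- WINDOW COMPOSITION (registered stub `stub_windowComposition` of the line `Sketch` for the
crux `GibbsLightCone`, stmt-AtomisticToContinuum-12501; deterministic, on one good orbit):
backward clusters compose over time windows (`backwardSweep_eq_sweep`; `clusterStep`
distributes over unions of the running set), hence a uniform per-window, per-particle span
bound `L` at the window endpoints forces `dist(x_j(0), x_i(nW)) ≤ n · L` for every
`j ∈ {i} ∪ BC(i, (0, nW])` (induction on `n`, triangle inequality for `Torus.euclidDist`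
through the position at time `nW` of an intermediate cluster member). [folklore] -/
theorem stub_windowComposition :
    ∀ (N : ℕ) (ε : ℝ) (Φ : HardSphereFlow (Torus.geometry (Fin 3)) ε N) (z : Config N (Fin 3) T3),
    z ∈ Φ.good → ∀ (W L : ℝ), 0 < W → ∀ n : ℕ,
      (∀ a : ℕ, a < n → ∀ q r : Fin N,
          (r = q ∨ r ∈ Φ.backwardCluster q (a * W) ((a + 1) * W) z) →
          Torus.euclidDist ((Φ.flow (a * W) z) r).1 ((Φ.flow ((a + 1) * W) z) q).1 ≤ L) →
      ∀ i j : Fin N, (j = i ∨ j ∈ Φ.backwardCluster i 0 (n * W) z) →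
        Torus.euclidDist (z j).1 ((Φ.flow (n * W) z) i).1 ≤ n * L := by
  intro N ε Φ z hz W L hW n
  induction n with
  | zero =>
    intro _ i j hj
    simp only [Nat.cast_zero, zero_mul] at hj ⊢
    rw [Φ.backwardCluster_apply hz, backwardCluster_of_le le_rfl] at hj
    rcases hj with rfl | hj
    · rw [Φ.flow_zero z hz, Torus.euclidDist_self]
    · exact absurd hj (Finset.notMem_empty j)
  | succ n ih =>
    intro hwin i j hj
    -- the first `n` windows: the induction hypothesis applies to every tagged particle
    have ih' := ih fun a ha => hwin a (Nat.lt_succ_of_lt ha)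
    push_cast at hj ⊢
    have hn0 : (0 : ℝ) ≤ n * W := mul_nonneg n.cast_nonneg hW.le
    have hn1 : (n : ℝ) * W ≤ (n + 1) * W := by nlinarith
    -- finitely many collisions of the (hard-sphere) orbit in the window `(0, (n+1)W]`
    have hfin : (collisionTimes (Torus.geometry (Fin 3)) ε (fun τ => Φ.flow τ z) ∩
        Ioc 0 ((n + 1) * W)).Finite :=
      ((Φ.isTrajectory z hz).locFinite 0 _).subset (inter_subset_inter_right _ Ioc_subset_Icc_self)
    rw [Φ.backwardCluster_apply hz] at hj
    -- split the window at `nW`: `j` is swept in over `(0, nW]` from some `q` swept in over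
    -- `(nW, (n+1)W]` from `i`
    obtain ⟨q, hq, hjq⟩ := windowComposition_exists_mem hn0 hn1 hfin hj
    rw [← Φ.backwardCluster_apply hz] at hq hjq
    -- `dist(x_j(0), x_q(nW)) ≤ n L` (induction) and `dist(x_q(nW), x_i((n+1)W)) ≤ L` (window `n`)
    have h1 := ih' q j hjq
    have h2 := hwin n (Nat.lt_succ_self n) i q hq
    calc Torus.euclidDist (z j).1 ((Φ.flow ((n + 1) * W) z) i).1
        ≤ Torus.euclidDist (z j).1 ((Φ.flow (n * W) z) q).1 +
            Torus.euclidDist ((Φ.flow (n * W) z) q).1 ((Φ.flow ((n + 1) * W) z) i).1 :=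
          torus_euclidDist_triangle _ _ _
      _ ≤ n * L + L := add_le_add h1 h2
      _ = (n + 1) * L := by ring

end Summit.AtomisticToContinuum.HydrodynamicLimit.Theorems.LogWindowTaggedTail
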